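import Summits.Ventures.PercRepro.ProfilePointedHomogeneous

/-!
# PercRepro — (Ĉ) AT EVERY POINT OF EVERY UNIFORM MATROID: RANK-BY-SIZE MATROIDS ARE EXTENSION-HOMOGENEOUS
(p10, gen 23; `proofs/P10-DIRECTSUM-g23.md` §5; modulo Theorem A = the named fact)

A matroid whose rank function on subsets of the ground set depends only on their size (`RankBySize M`) is exactly a
uniform matroid `U_{r,n}` (`rk X = min (#X) r`; `rankBySize_of_min`).  Such a matroid is extension-homogeneous:
the transposition `σ = Equiv.swap p q` of two points maps the ground set onto itself (`map_swap_gr`), preserves every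
cardinality, hence every rank (`RankBySize`), hence bi-independence (`mem_biIndepSets_map_swap`), and carries the
extendable `k`-sets of `p` bijectively onto those of `q` (`extCount_eq_of_rankBySize`, `Finset.card_nbij'`).  With
`ProfilePointedHomogeneous.lean`: (Ĉ) holds at every level of every point of every uniform matroid
(`pointedRowAt_of_rankBySize`), and of every direct sum of two uniform matroids
(`pointedRowAt_disjointSum_of_rankBySize`) — CONDITIONAL on the named fact and on nothing else.  Nothing here
asserts (Ĉ).
-/

open scoped Matroid

namespace PercRepro.Cogirth

open Finset ThmH Skew

variable {α : Type} [DecidableEq α] {M : Matroid α} [M.Finite]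

/-- **Rank by size**: the rank of a subset of the ground set depends only on its cardinality — the uniform matroids. -/
def RankBySize (M : Matroid α) [M.Finite] : Prop :=
  ∀ X Y : Finset α, X ⊆ gr M → Y ⊆ gr M → X.card = Y.card → rk M X = rk M Y

omit [DecidableEq α] in
/-- A matroid with `rk X = min (#X) r` on the ground set (the uniform matroid `U_{r,n}`) has rank by size. -/
theorem rankBySize_of_min {r : ℕ} (h : ∀ X : Finset α, X ⊆ gr M → rk M X = min X.card r) : RankBySize M := by
  intro X Y hX hY hXY
  rw [h X hX, h Y hY, hXY]

section swap

variable {p q : α}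

/-- The transposition of two points of the ground set keeps subsets of the ground set inside it. -/
theorem map_swap_subset_gr (hp : p ∈ gr M) (hq : q ∈ gr M) {X : Finset α} (hX : X ⊆ gr M) :
    X.map (Equiv.swap p q).toEmbedding ⊆ gr M := by
  intro y hy
  rw [mem_map] at hy
  obtain ⟨x, hx, rfl⟩ := hy
  simp only [Equiv.coe_toEmbedding, Equiv.swap_apply_def]
  split_ifs
  · exact hq
  · exact hp
  · exact hX hx

/-- The transposition of two points of the ground set maps the ground set onto itself. -/
theorem map_swap_gr (hp : p ∈ gr M) (hq : q ∈ gr M) : (gr M).map (Equiv.swap p q).toEmbedding = gr M := by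
  apply Finset.Subset.antisymm (map_swap_subset_gr hp hq (Finset.Subset.refl _))
  intro y hy
  rw [mem_map_equiv, Equiv.symm_swap, Equiv.swap_apply_def]
  split_ifs
  · exact hq
  · exact hp
  · exact hy

/-- The transposition of two points is an involution on finsets. -/
theorem map_swap_map_swap (X : Finset α) :
    (X.map (Equiv.swap p q).toEmbedding).map (Equiv.swap p q).toEmbedding = X := by
  ext y
  simp only [mem_map_equiv, Equiv.symm_swap, Equiv.swap_apply_self]

/-- Under rank by size, the transposition of two points of the ground set preserves bi-independence. -/
theorem mem_biIndepSets_map_swap (hU : RankBySize M) (hp : p ∈ gr M) (hq : q ∈ gr M) {k : ℕ} {X : Finset α}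
    (hX : X ∈ biIndepSets M k) : X.map (Equiv.swap p q).toEmbedding ∈ biIndepSets M k := by
  rw [mem_biIndepSets] at hX ⊢
  obtain ⟨hXg, hXk, hXr, hXc⟩ := hX
  have hXg' := map_swap_subset_gr hp hq hXg
  refine ⟨hXg', by rw [card_map, hXk], ?_, ?_⟩
  · rw [hU _ _ hXg' hXg (card_map _), card_map, hXr]
  · have e1 : gr M \ X.map (Equiv.swap p q).toEmbedding = (gr M \ X).map (Equiv.swap p q).toEmbedding := by
      rw [Finset.map_sdiff, map_swap_gr hp hq]
    rw [e1, hU _ _ (map_swap_subset_gr hp hq sdiff_subset) sdiff_subset (card_map _), card_map, hXc]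

/-- Under rank by size, the transposition of `p` and `q` carries the extendable `k`-sets of `p` into those of `q`. -/
theorem map_swap_mem_filter_ext (hU : RankBySize M) (hp : p ∈ gr M) (hq : q ∈ gr M) {k : ℕ} {X : Finset α}
    (hX : X ∈ (biIndepSets M k).filter (fun X => p ∉ X ∧ insert p X ∈ biIndepSets M (k + 1))) :
    X.map (Equiv.swap p q).toEmbedding ∈
      (biIndepSets M k).filter (fun X => q ∉ X ∧ insert q X ∈ biIndepSets M (k + 1)) := by
  rw [mem_filter] at hX ⊢
  obtain ⟨hX, hpX, hins⟩ := hX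
  refine ⟨mem_biIndepSets_map_swap hU hp hq hX, ?_, ?_⟩
  · rw [mem_map_equiv, Equiv.symm_swap, Equiv.swap_apply_right]
    exact hpX
  · have := mem_biIndepSets_map_swap hU hp hq hins
    rw [map_insert, Equiv.coe_toEmbedding, Equiv.swap_apply_left] at this
    exact this

/-- **Under rank by size the extension counts are point-independent.** -/
theorem extCount_eq_of_rankBySize (hU : RankBySize M) (hp : p ∈ gr M) (hq : q ∈ gr M) (k : ℕ) :
    extCount M k p = extCount M k q := by
  unfold extCount
  apply Finset.card_nbij' (fun X => X.map (Equiv.swap p q).toEmbedding)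
    (fun X => X.map (Equiv.swap p q).toEmbedding)
  · intro X hX
    rw [Finset.mem_coe] at hX ⊢
    exact map_swap_mem_filter_ext hU hp hq hX
  · intro X hX
    rw [Finset.mem_coe] at hX ⊢
    have := map_swap_mem_filter_ext hU hq hp hX
    rwa [Equiv.swap_comm] at this
  · intro X _
    exact map_swap_map_swap X
  · intro X _
    exact map_swap_map_swap X

end swap

/-- **Rank-by-size matroids are extension-homogeneous.** -/
theorem extHomogeneous_of_rankBySize (hU : RankBySize M) : ExtHomogeneous M :=
  fun k _ hp _ hq => extCount_eq_of_rankBySize hU hp hq k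

/-- **(Ĉ) AT EVERY POINT OF EVERY UNIFORM MATROID** (CONDITIONAL on the named fact). -/
theorem pointedRowAt_of_rankBySize (hfact : BiIndepDensityLogConcave α) (hU : RankBySize M) {p : α}
    (hp : p ∈ gr M) : PointedRowAt M p :=
  pointedRowAt_of_extHomogeneous hfact M (extHomogeneous_of_rankBySize hU) hp

/-- **(Ĉ) AT EVERY POINT OF A DIRECT SUM OF TWO UNIFORM MATROIDS** (CONDITIONAL on the named fact). -/
theorem pointedRowAt_disjointSum_of_rankBySize (hfact : BiIndepDensityLogConcave α) {M₁ M₂ : Matroid α}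
    [M₁.Finite] [M₂.Finite] (h : Disjoint M₁.E M₂.E) [(M₁.disjointSum M₂ h).Finite]
    (h₁ : RankBySize M₁) (h₂ : RankBySize M₂) {p : α} (hp : p ∈ gr (M₁.disjointSum M₂ h)) :
    PointedRowAt (M₁.disjointSum M₂ h) p :=
  pointedRowAt_disjointSum_of_extHomogeneous hfact h (extHomogeneous_of_rankBySize h₁)
    (extHomogeneous_of_rankBySize h₂) hp

end PercRepro.Cogirth
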